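import Mathlib.Analysis.SpecialFunctions.Pow.Real
import Mathlib.Analysis.SpecialFunctions.Pow.Complex
import Mathlib.Topology.Algebra.InfiniteSum.Real
import HarnessLib

/-!
# The trivial-zero series in Montgomery's explicit formula

Trunk T-ANT (`Literature/NumberTheory/LFunctions`). Proofs only. In the explicit formula behind
(P1) `montgomery_explicit_formula` (Montgomery 1973, Lemma; Goldston 2005, Proposition 1), the
contributions of the trivial zeros `−2(j+1)` of `ζ` through the pair kernel
`k(w) = 1/(w − s₁) − 1/(w − s₂)`, `s₁ = −1/2 + it`, `s₂ = 3/2 + it`, form the remainder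
"`∑_n x^{−2n}(1/(2n − 1/2 + it) − 1/(2n + 3/2 + it)) = O(x^{−2}/(|t| + 2))`" of Goldston's proof.
Here the bound with explicit constants:

* `Montgomery.norm_pairKernel_trivialZero_le` : `‖k(−2(j+1))‖ ≤ 8/((2j + 3/2 + |t|)(2j + 7/2 + |t|))`;
* `Montgomery.tsum_trivialZero_pairKernel_le` : for `x ≥ 1`,
  `∑_{j ≥ 0} x^{−2(j+1)} ‖k(−2(j+1))‖ ≤ 6 x^{−2}/(|t| + 2)` (the series telescopes:
  `8/(a(a+2)) = 4(1/a − 1/(a+2))`, `a = 2j + 3/2 + |t|`).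

## References

* D. A. Goldston, *Notes on pair correlation of zeros and prime numbers*, LMS Lecture Note Ser. 322
  (2005), proof of Proposition 1.
* H. L. Montgomery, *The pair correlation of zeros of the zeta function*, Proc. Sympos. Pure Math. 24
  (1973), 181–193, Lemma.
-/

noncomputable section

open Complex Filter Set
open scoped Real Topology

namespace Literature.NumberTheory.LFunctions

namespace Montgomery

/-- `√(a² + b²) ≥ (|a| + |b|)/2`, in the form `‖z‖ ≥ (|Re z| + |Im z|)/2`. [folklore] -/
theorem abs_re_add_abs_im_le_two_mul_norm (z : ℂ) : |z.re| + |z.im| ≤ 2 * ‖z‖ := by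
  linarith [Complex.abs_re_le_norm z, Complex.abs_im_le_norm z]

/-- The pair kernel `k(w) = 1/(w − s₁) − 1/(w − s₂)`, `s₁ = −1/2 + it`, `s₂ = 3/2 + it`, at the trivial
zeros `w = −2(j+1)`: `‖k(−2(j+1))‖ ≤ 8/((2j + 3/2 + |t|)(2j + 7/2 + |t|))`. [folklore] -/
theorem norm_pairKernel_trivialZero_le (t : ℝ) (j : ℕ) :
    ‖1 / ((-(2 * ((j : ℂ) + 1))) - ((-(1 / 2 : ℝ) : ℂ) + t * I)) -
        1 / ((-(2 * ((j : ℂ) + 1))) - (((3 / 2 : ℝ) : ℂ) + t * I))‖ ≤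
      8 / ((2 * j + 3 / 2 + |t|) * (2 * j + 7 / 2 + |t|)) := by
  set w₁ : ℂ := (-(2 * ((j : ℂ) + 1))) - ((-(1 / 2 : ℝ) : ℂ) + t * I) with hw₁
  set w₂ : ℂ := (-(2 * ((j : ℂ) + 1))) - (((3 / 2 : ℝ) : ℂ) + t * I) with hw₂
  have hj : (0 : ℝ) ≤ j := Nat.cast_nonneg j
  have hw₁re : w₁.re = -(2 * j + 3 / 2) := by simp [hw₁]; ring
  have hw₁im : w₁.im = -t := by simp [hw₁]
  have hw₂re : w₂.re = -(2 * j + 7 / 2) := by simp [hw₂]; ring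
  have hw₂im : w₂.im = -t := by simp [hw₂]
  have hn₁ : 2 * j + 3 / 2 + |t| ≤ 2 * ‖w₁‖ := by
    have := abs_re_add_abs_im_le_two_mul_norm w₁
    rw [hw₁re, hw₁im, abs_neg, abs_neg, abs_of_pos (by positivity)] at this
    exact this
  have hn₂ : 2 * j + 7 / 2 + |t| ≤ 2 * ‖w₂‖ := by
    have := abs_re_add_abs_im_le_two_mul_norm w₂
    rw [hw₂re, hw₂im, abs_neg, abs_neg, abs_of_pos (by positivity)] at this
    exact this
  have hpos₁ : 0 < 2 * j + 3 / 2 + |t| := by positivity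
  have hpos₂ : 0 < 2 * j + 7 / 2 + |t| := by positivity
  have hw₁0 : w₁ ≠ 0 := by
    intro h; rw [h, norm_zero] at hn₁; linarith
  have hw₂0 : w₂ ≠ 0 := by
    intro h; rw [h, norm_zero] at hn₂; linarith
  -- `1/w₁ − 1/w₂ = (w₂ − w₁)/(w₁ w₂)` and `w₂ − w₁ = −2`
  have e : 1 / w₁ - 1 / w₂ = -2 / (w₁ * w₂) := by
    have : w₂ - w₁ = -2 := by simp only [hw₁, hw₂]; push_cast; ring
    rw [div_sub_div _ _ hw₁0 hw₂0, ← this]; ring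
  rw [e, norm_div, norm_neg, Complex.norm_two, norm_mul]
  rw [div_le_div_iff₀ (by positivity) (by positivity)]
  nlinarith [mul_le_mul hn₁ hn₂ hpos₂.le (by positivity), norm_nonneg w₁, norm_nonneg w₂]

/-- **The trivial-zero series of Montgomery's explicit formula** (Goldston 2005, proof of
Proposition 1: the term `∑_n x^{−2n}(1/(2n − 1/2 + it) − 1/(2n + 3/2 + it)) = O(x^{−2}/(|t|+2))`):
for `x ≥ 1` and real `t`,
`∑_{j ≥ 0} x^{−2(j+1)} ‖k(−2(j+1))‖ ≤ 6 x^{−2}/(|t| + 2)`, `k(w) = 1/(w − s₁) − 1/(w − s₂)`,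
`s₁ = −1/2 + it`, `s₂ = 3/2 + it` (telescoping: `8/((a)(a+2)) = 4(1/a − 1/(a+2))`, `a = 2j + 3/2 + |t|`). [cite: Goldston2005, proof of Proposition 1] -/
theorem tsum_trivialZero_pairKernel_le {x : ℝ} (hx : 1 ≤ x) (t : ℝ) :
    ∑' j : ℕ, x ^ (-(2 * ((j : ℝ) + 1))) *
        ‖1 / ((-(2 * ((j : ℂ) + 1))) - ((-(1 / 2 : ℝ) : ℂ) + t * I)) -
          1 / ((-(2 * ((j : ℂ) + 1))) - (((3 / 2 : ℝ) : ℂ) + t * I))‖ ≤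
      6 * x ^ (-2 : ℝ) / (|t| + 2) := by
  have hx0 : 0 < x := by linarith
  set a : ℕ → ℝ := fun j ↦ 2 * j + 3 / 2 + |t| with ha
  have ha0 : ∀ j, 0 < a j := fun j ↦ by simp only [ha]; positivity
  have hstep : ∀ j, a (j + 1) = a j + 2 := fun j ↦ by simp only [ha]; push_cast; ring
  -- termwise bound by a telescoping sequence
  have hterm : ∀ j : ℕ, x ^ (-(2 * ((j : ℝ) + 1))) *
      ‖1 / ((-(2 * ((j : ℂ) + 1))) - ((-(1 / 2 : ℝ) : ℂ) + t * I)) -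
        1 / ((-(2 * ((j : ℂ) + 1))) - (((3 / 2 : ℝ) : ℂ) + t * I))‖ ≤
      x ^ (-2 : ℝ) * (4 * (1 / a j - 1 / a (j + 1))) := by
    intro j
    have h1 := norm_pairKernel_trivialZero_le t j
    have hpow : x ^ (-(2 * ((j : ℝ) + 1))) ≤ x ^ (-2 : ℝ) :=
      Real.rpow_le_rpow_of_exponent_le hx (by nlinarith [j.cast_nonneg (α := ℝ)])
    have htel : 8 / ((2 * j + 3 / 2 + |t|) * (2 * j + 7 / 2 + |t|)) = 4 * (1 / a j - 1 / a (j + 1)) := by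
      rw [hstep]
      simp only [ha]
      have := ha0 j
      field_simp
      ring
    calc _ ≤ x ^ (-2 : ℝ) * (8 / ((2 * j + 3 / 2 + |t|) * (2 * j + 7 / 2 + |t|))) :=
          mul_le_mul hpow h1 (norm_nonneg _) (by positivity)
      _ = x ^ (-2 : ℝ) * (4 * (1 / a j - 1 / a (j + 1))) := by rw [htel]
  -- partial sums telescope
  have hpartial : ∀ J : ℕ, ∑ j ∈ Finset.range J, x ^ (-2 : ℝ) * (4 * (1 / a j - 1 / a (j + 1))) =
      x ^ (-2 : ℝ) * (4 * (1 / a 0 - 1 / a J)) := by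
    intro J
    induction J with
    | zero => simp
    | succ J ih => rw [Finset.sum_range_succ, ih]; ring
  refine Real.tsum_le_of_sum_range_le (fun j ↦ by positivity) fun J ↦ ?_
  calc ∑ j ∈ Finset.range J, x ^ (-(2 * ((j : ℝ) + 1))) *
        ‖1 / ((-(2 * ((j : ℂ) + 1))) - ((-(1 / 2 : ℝ) : ℂ) + t * I)) -
          1 / ((-(2 * ((j : ℂ) + 1))) - (((3 / 2 : ℝ) : ℂ) + t * I))‖
      ≤ ∑ j ∈ Finset.range J, x ^ (-2 : ℝ) * (4 * (1 / a j - 1 / a (j + 1))) := Finset.sum_le_sum fun j _ ↦ hterm j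
    _ = x ^ (-2 : ℝ) * (4 * (1 / a 0 - 1 / a J)) := hpartial J
    _ ≤ x ^ (-2 : ℝ) * (4 * (1 / a 0)) := by
        have : 0 ≤ 1 / a J := by positivity
        have : (0 : ℝ) ≤ x ^ (-2 : ℝ) := by positivity
        nlinarith
    _ ≤ 6 * x ^ (-2 : ℝ) / (|t| + 2) := by
        have ha0' : a 0 = 3 / 2 + |t| := by simp [ha]
        rw [ha0', le_div_iff₀ (by positivity)]
        have h4 : 4 * (1 / (3 / 2 + |t|)) * (|t| + 2) ≤ 6 := by
          rw [mul_one_div, div_mul_eq_mul_div, div_le_iff₀ (by positivity)]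
          nlinarith [abs_nonneg t]
        have : (0 : ℝ) ≤ x ^ (-2 : ℝ) := by positivity
        nlinarith

end Montgomery

end Literature.NumberTheory.LFunctions
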